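import Literature.MathematicalPhysics.QuantumLattice.GroundStateInfraredBoundEveryState
import Literature.MathematicalPhysics.QuantumLattice.SectorSpectrum
import HarnessLib

/-!
# The spectral (Feynman–Bijl / yrast) mode bound in every ground state: `ω · S ≤ D`

Companion of `GroundStateInfraredBoundEveryState.lean` (the Gaussian-domination route to a mode
ceiling). Here the `k ≠ 0` input is SPECTRAL instead: if the states `Aρ` created from a ground-supported
state `ρ` (`ρ ⪰ 0`, `Hρ = E₀ρ`) by a mode operator `A` lie in a subspace on which `H ≥ E₀ + ω` — a
sector / "yrast" excitation gap `ω` for the quantum numbers carried by `A` — then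
`ω · Re tr(ρ A†A) ≤ Re tr(ρ A†(H − E₀)A)`, and with the same for `A†`,
`ω · Re tr(ρ (A†A + AA†)) ≤ Re tr(ρ [A†,[H,A]])`, i.e. `S ≤ D/ω`: the Bijl–Feynman bound
`ω_{exc} ≤ f/S` read backwards (Feynman 1954; Pitaevskii–Stringari 1991, the `m₀ ≤ m₁/ω_min` member of
the moment inequalities; Lipparini 2008 eq. (8.33)). No Cauchy–Schwarz, no Gaussian domination, no
reflection positivity; every ground state (degenerate or not) is treated uniformly.

Results (all PROVED; no definition, no named fact):
* `trace_doubleCommutator_eq_of_groundSupported` — for `Hρ = E₀ρ = ρH`,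
  `tr(ρ[A†,[H,A]]) = tr(ρA†(H−E₀)A) + tr(ρA(H−E₀)A†)` with `[A†,[H,A]] = A†(HA − AH) − (HA − AH)A†`.
* `gap_mul_trace_le_of_sectorGap` — ONE-SIDED STEP: `P(Aρ) = Aρ` and `P†(H − E₀ − ω)P ⪰ 0` give
  `ω · Re tr(ρA†A) ≤ Re tr(ρA†(H−E₀)A)`.
* `gap_mul_trace_le_doubleCommutator_of_sectorGaps` — both sides (`A` into `P`, `A†` into `P'`, common
  gap `ω`): `ω · Re tr(ρ(A†A + AA†)) ≤ Re tr(ρ[A†,[H,A]])`; CERTIFIED-INPUT COROLLARY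
  `trace_le_div_of_sectorGaps`: `0 < ω`, `Re tr(ρ[A†,[H,A]]) ≤ D` ⇒ `Re tr(ρ(A†A + AA†)) ≤ D/ω`.
* Hermitian mode `V`: `two_mul_gap_mul_trace_sq_le_doubleCommutator`, `trace_sq_le_div_of_sectorGap`
  (`Re tr(ρV²) ≤ D/(2ω)`).
* VECTOR / SECTOR forms over the tree's sector energy `Matrix.minEnergyOn H K`:
  `minEnergyOn_mul_le_rayleigh_of_mem` (`E_K · ⟨v,v⟩ ≤ Re⟨v,Hv⟩` for `v ∈ K`),
  `gap_mul_normSq_le_of_mem_sector` (`Hψ = E₀ψ`, `Aψ ∈ K`, `E₀ + ω ≤ E_K` ⇒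
  `ω‖Aψ‖² ≤ Re⟨Aψ,(H−E₀)Aψ⟩`), `dotProduct_doubleCommutator_eq` and
  `gap_mul_fluctuation_le_doubleCommutator_of_mem_sectors` (`ω(‖Aψ‖² + ‖A†ψ‖²) ≤ Re⟨ψ,[A†,[H,A]]ψ⟩`).

Scope (not a claim): this is the "provable now" support inequality `S ≤ D/ω for any operator and any
ground state` named by the summit's idea card `yrast-landau-ir-step` and by route `KacWindowPenalty`
crux (3); the HYPOTHESIS (a sector/yrast gap `ω(q) ≥ v|q|` for the `(N±2, ±q)` sectors of a lattice-fermion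
torus, or any certified channel gap) is NOT asserted here for any model and is the open input; for which
models it fails (stripe / pocket phases) see that card. Combined with a sum rule over modes (KLS
arithmetic, `XYOrderProofs`) the per-mode ceilings give a `k = 0` floor; that assembly is not in this file.

## References
* R. P. Feynman, Phys. Rev. 94 (1954) 262–277 [Feynman1954], §III (the excitation-energy bound `ε(k) ≤ ħ²k²/(2mS(k))`).
* L. Pitaevskii, S. Stringari, J. Low Temp. Phys. 85 (1991) 377–388 [PitaevskiiStringari1991], §2
  (moment inequalities at `T = 0`).
* E. Lipparini, *Modern Many-Particle Physics*, 2nd ed. (2008), p. 319 eq. (8.33) [Lipparini2008]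
  (`m₋₁ ≤ m₀/ω_min`, `m₀ ≤ m₁/ω_min`).
* H. Tasaki, *Physics and Mathematics of Quantum Many-Body Systems* (2020), §2.2 [Tasaki2020] (sector energies).
-/

noncomputable section

open Matrix
open scoped ComplexOrder

namespace Literature.MathematicalPhysics.QuantumLattice

variable {m : Type*} [Fintype m] [DecidableEq m]

/-! ### The double commutator of a non-Hermitian mode in a ground-supported state -/

/-- For `ρ` supported on the ground space of `H` (`Hρ = E₀ρ = ρH`) and any `A`:
`tr(ρ[A†,[H,A]]) = tr(ρ A†(H−E₀)A) + tr(ρ A(H−E₀)A†)`, `[A†,[H,A]] = A†(HA − AH) − (HA − AH)A†` —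
the two one-sided "`f`-sum" moments of the strength functions of `A` and `A†`.
[cite: PitaevskiiStringari1991, §2] -/
theorem trace_doubleCommutator_eq_of_groundSupported {H A ρ : Matrix m m ℂ} {E₀ : ℂ}
    (hHρ : H * ρ = E₀ • ρ) (hρH : ρ * H = E₀ • ρ) :
    (ρ * (Aᴴ * (H * A - A * H) - (H * A - A * H) * Aᴴ)).trace =
      (ρ * (Aᴴ * (H - E₀ • 1) * A)).trace + (ρ * (A * (H - E₀ • 1) * Aᴴ)).trace := by
  have h1 : (ρ * (Aᴴ * A * H)).trace = E₀ * (ρ * (Aᴴ * A)).trace := by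
    rw [← mul_assoc, trace_mul_cycle, hHρ, Matrix.smul_mul, trace_smul, smul_eq_mul]
  have h2 : (ρ * (H * (A * Aᴴ))).trace = E₀ * (ρ * (A * Aᴴ)).trace := by
    rw [← mul_assoc, hρH, Matrix.smul_mul, trace_smul, smul_eq_mul]
  have hL : (ρ * (Aᴴ * (H * A - A * H) - (H * A - A * H) * Aᴴ)).trace =
      (ρ * (Aᴴ * H * A)).trace - (ρ * (Aᴴ * A * H)).trace - (ρ * (H * (A * Aᴴ))).trace +
        (ρ * (A * H * Aᴴ)).trace := by
    rw [mul_sub Aᴴ, sub_mul _ _ Aᴴ, ← mul_assoc Aᴴ H A, ← mul_assoc Aᴴ A H, mul_assoc H A Aᴴ,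
      show Aᴴ * H * A - Aᴴ * A * H - (H * (A * Aᴴ) - A * H * Aᴴ) =
        Aᴴ * H * A - Aᴴ * A * H - H * (A * Aᴴ) + A * H * Aᴴ by abel,
      mul_add, mul_sub, mul_sub, trace_add, trace_sub, trace_sub]
  have hR1 : (ρ * (Aᴴ * (H - E₀ • 1) * A)).trace = (ρ * (Aᴴ * H * A)).trace - E₀ * (ρ * (Aᴴ * A)).trace := by
    rw [mul_sub, sub_mul, Matrix.mul_smul, mul_one, Matrix.smul_mul, mul_sub, trace_sub,
      Matrix.mul_smul, trace_smul, smul_eq_mul]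
  have hR2 : (ρ * (A * (H - E₀ • 1) * Aᴴ)).trace = (ρ * (A * H * Aᴴ)).trace - E₀ * (ρ * (A * Aᴴ)).trace := by
    rw [mul_sub, sub_mul, Matrix.mul_smul, mul_one, Matrix.smul_mul, mul_sub, trace_sub,
      Matrix.mul_smul, trace_smul, smul_eq_mul]
  rw [hL, hR1, hR2, h1, h2]
  ring

/-! ### The one-sided spectral step -/

section Matrix

variable {H A P ρ : Matrix m m ℂ} {ω : ℝ}

/-- **One-sided Feynman–Bijl / yrast step.** Let `ρ ⪰ 0` (any state; ground support is not needed
for this half), let `P` fix the states created by `A` from `ρ` (`P(Aρ) = Aρ`; e.g. the projection onto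
the symmetry sector `A` maps the support of `ρ` into) and suppose the gap `P†(H − E₀ − ω)P ⪰ 0`,
`E₀ = E₀(H)`. Then `ω · Re tr(ρA†A) ≤ Re tr(ρ A†(H − E₀)A)` (`ω · m₀ ≤ m₁` for the strength function
of `A` when `ρ` is a ground state).
[cite: PitaevskiiStringari1991, §2] [cite: Lipparini2008, p. 319 eq. (8.33)] -/
theorem gap_mul_trace_le_of_sectorGap (hρ : ρ.PosSemidef) (hPA : P * (A * ρ) = A * ρ)
    (hgap : (Pᴴ * (H - ((H.groundEnergy + ω : ℝ) : ℂ) • 1) * P).PosSemidef) :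
    ω * (ρ * (Aᴴ * A)).trace.re ≤ (ρ * (Aᴴ * (H - (H.groundEnergy : ℂ) • 1) * A)).trace.re := by
  set K' : Matrix m m ℂ := H - ((H.groundEnergy + ω : ℝ) : ℂ) • 1 with hK'_def
  -- `A ρ A† ⪰ 0`
  have hS : (A * ρ * Aᴴ).PosSemidef := hρ.mul_mul_conjTranspose_same A
  have h0 := Literature.LinearAlgebra.Matrix.re_trace_mul_nonneg_of_posSemidef hS hgap
  -- `ρ A† P† = ρ A†`
  have hρAP : ρ * Aᴴ * Pᴴ = ρ * Aᴴ := by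
    have h := congrArg conjTranspose hPA
    rw [conjTranspose_mul, conjTranspose_mul, hρ.1.eq] at h
    exact h
  -- `tr(AρA† · P†K'P) = tr(ρ A† K' A)`
  have htr : (A * ρ * Aᴴ * (Pᴴ * K' * P)).trace = (ρ * (Aᴴ * K' * A)).trace := by
    calc (A * ρ * Aᴴ * (Pᴴ * K' * P)).trace = (P * (A * ρ) * (Aᴴ * Pᴴ) * K').trace := by
          rw [← Matrix.mul_assoc (A * ρ * Aᴴ) (Pᴴ * K') P, trace_mul_cycle (A * ρ * Aᴴ) (Pᴴ * K') P]
          simp only [Matrix.mul_assoc]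
      _ = (A * (ρ * Aᴴ * Pᴴ) * K').trace := by rw [hPA]; simp only [Matrix.mul_assoc]
      _ = (A * (ρ * (Aᴴ * K'))).trace := by rw [hρAP]; simp only [Matrix.mul_assoc]
      _ = (ρ * (Aᴴ * K' * A)).trace := by rw [trace_mul_comm A]; simp only [Matrix.mul_assoc]
  rw [htr] at h0
  -- `tr(ρ A† K' A) = tr(ρ A†(H−E₀)A) − ω tr(ρ A†A)`
  have hsplit : (ρ * (Aᴴ * K' * A)).trace =
      (ρ * (Aᴴ * (H - (H.groundEnergy : ℂ) • 1) * A)).trace - (ω : ℂ) * (ρ * (Aᴴ * A)).trace := by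
    rw [hK'_def, Complex.ofReal_add, add_smul,
      show H - ((H.groundEnergy : ℂ) • (1 : Matrix m m ℂ) + (ω : ℂ) • 1) =
        (H - (H.groundEnergy : ℂ) • 1) - (ω : ℂ) • 1 by abel,
      mul_sub Aᴴ, sub_mul _ _ A, Matrix.mul_smul, mul_one, Matrix.smul_mul, mul_sub, trace_sub,
      Matrix.mul_smul, trace_smul, smul_eq_mul]
  rw [hsplit, Complex.sub_re, Complex.re_ofReal_mul] at h0
  linarith

end Matrix

/-! ### Both sides: `ω · S ≤ D` and the certified-input ceiling `S ≤ D/ω` -/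

section TwoSided

variable {H A P P' ρ : Matrix m m ℂ} {ω : ℝ}

/-- **`ω · S ≤ D` in every ground state.** If `A` maps the ground-supported `ρ` into `P` and `A†` into
`P'`, both with spectral gap `ω` above `E₀` (`P†(H − E₀ − ω)P ⪰ 0`, `P'†(H − E₀ − ω)P' ⪰ 0`), then
`ω · Re tr(ρ(A†A + AA†)) ≤ Re tr(ρ[A†,[H,A]])` — Feynman–Bijl backwards: a floor on the excitation
energy of the quantum numbers of `A` is a ceiling on its fluctuation.
[cite: Feynman1954, §III] [cite: PitaevskiiStringari1991, §2] -/
theorem gap_mul_trace_le_doubleCommutator_of_sectorGaps (hH : H.IsHermitian) (hρ : ρ.PosSemidef)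
    (hHρ : H * ρ = (H.groundEnergy : ℂ) • ρ) (hPA : P * (A * ρ) = A * ρ)
    (hP'A : P' * (Aᴴ * ρ) = Aᴴ * ρ)
    (hgap : (Pᴴ * (H - ((H.groundEnergy + ω : ℝ) : ℂ) • 1) * P).PosSemidef)
    (hgap' : (P'ᴴ * (H - ((H.groundEnergy + ω : ℝ) : ℂ) • 1) * P').PosSemidef) :
    ω * (ρ * (Aᴴ * A + A * Aᴴ)).trace.re ≤
      (ρ * (Aᴴ * (H * A - A * H) - (H * A - A * H) * Aᴴ)).trace.re := by
  have h1 := gap_mul_trace_le_of_sectorGap hρ hPA hgap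
  have h2 := gap_mul_trace_le_of_sectorGap (A := Aᴴ) hρ hP'A hgap'
  rw [conjTranspose_conjTranspose] at h2
  rw [trace_doubleCommutator_eq_of_groundSupported hHρ (mul_eq_smul_of_hermitian' hH hρ.1 hHρ),
    Complex.add_re, mul_add, trace_add, Complex.add_re, mul_add]
  exact add_le_add h1 h2
where
  /-- `ρH = E₀ρ` from `Hρ = E₀ρ` (Hermitian `H`, `ρ`). [folklore] -/
  mul_eq_smul_of_hermitian' {H ρ : Matrix m m ℂ} (hH : H.IsHermitian) (hρ : ρ.IsHermitian)
      (hHρ : H * ρ = (H.groundEnergy : ℂ) • ρ) : ρ * H = (H.groundEnergy : ℂ) • ρ := by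
    have h := congrArg conjTranspose hHρ
    rw [conjTranspose_mul, conjTranspose_smul, hρ.eq, hH.eq, Complex.star_def,
      Complex.conj_ofReal] at h
    exact h

/-- **Certified-input corollary `S ≤ D/ω`.** Under the hypotheses of
`gap_mul_trace_le_doubleCommutator_of_sectorGaps` with `0 < ω` and a double-commutator ceiling
`Re tr(ρ[A†,[H,A]]) ≤ D`: `Re tr(ρ(A†A + AA†)) ≤ D/ω` — a structure-factor ceiling from a certified
sector gap and a certified (or a-priori, by locality) `f`-sum moment. [cite: Feynman1954, §III]
[cite: Lipparini2008, p. 319 eq. (8.33)] -/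
theorem trace_le_div_of_sectorGaps (hH : H.IsHermitian) (hρ : ρ.PosSemidef)
    (hHρ : H * ρ = (H.groundEnergy : ℂ) • ρ) (hPA : P * (A * ρ) = A * ρ)
    (hP'A : P' * (Aᴴ * ρ) = Aᴴ * ρ) (hω : 0 < ω)
    (hgap : (Pᴴ * (H - ((H.groundEnergy + ω : ℝ) : ℂ) • 1) * P).PosSemidef)
    (hgap' : (P'ᴴ * (H - ((H.groundEnergy + ω : ℝ) : ℂ) • 1) * P').PosSemidef)
    {D : ℝ} (hD : (ρ * (Aᴴ * (H * A - A * H) - (H * A - A * H) * Aᴴ)).trace.re ≤ D) :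
    (ρ * (Aᴴ * A + A * Aᴴ)).trace.re ≤ D / ω := by
  rw [le_div_iff₀ hω, mul_comm]
  exact (gap_mul_trace_le_doubleCommutator_of_sectorGaps hH hρ hHρ hPA hP'A hgap hgap').trans hD

end TwoSided

/-! ### Hermitian mode -/

section Hermitian

variable {H V P ρ : Matrix m m ℂ} {ω : ℝ}

/-- For a Hermitian mode `V` mapping the ground-supported `ρ` into a gapped sector:
`2ω · Re tr(ρV²) ≤ Re tr(ρ[V,[H,V]])`. [cite: PitaevskiiStringari1991, §2] -/
theorem two_mul_gap_mul_trace_sq_le_doubleCommutator (hH : H.IsHermitian) (hV : V.IsHermitian)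
    (hρ : ρ.PosSemidef) (hHρ : H * ρ = (H.groundEnergy : ℂ) • ρ) (hPV : P * (V * ρ) = V * ρ)
    (hgap : (Pᴴ * (H - ((H.groundEnergy + ω : ℝ) : ℂ) • 1) * P).PosSemidef) :
    2 * ω * (ρ * (V * V)).trace.re ≤ (ρ * (V * (H * V - V * H) - (H * V - V * H) * V)).trace.re := by
  have h := gap_mul_trace_le_doubleCommutator_of_sectorGaps (A := V) (P' := P) hH hρ hHρ hPV
    (by rw [hV.eq]; exact hPV) hgap hgap
  rw [hV.eq, mul_add, trace_add, Complex.add_re] at h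
  linarith

/-- **Certified-input mode ceiling, spectral form**: `0 < ω`, the sector gap for `Vρ`, and
`Re tr(ρ[V,[H,V]]) ≤ D` give `Re tr(ρV²) ≤ D/(2ω)` in every ground-supported state — the spectral
alternative to the Gaussian-domination ceiling `trace_sq_le_half_sqrt_of_groundSupported`.
[cite: Feynman1954, §III] [cite: Lipparini2008, p. 319 eq. (8.33)] -/
theorem trace_sq_le_div_of_sectorGap (hH : H.IsHermitian) (hV : V.IsHermitian)
    (hρ : ρ.PosSemidef) (hHρ : H * ρ = (H.groundEnergy : ℂ) • ρ) (hPV : P * (V * ρ) = V * ρ)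
    (hω : 0 < ω) (hgap : (Pᴴ * (H - ((H.groundEnergy + ω : ℝ) : ℂ) • 1) * P).PosSemidef)
    {D : ℝ} (hD : (ρ * (V * (H * V - V * H) - (H * V - V * H) * V)).trace.re ≤ D) :
    (ρ * (V * V)).trace.re ≤ D / (2 * ω) := by
  rw [le_div_iff₀ (by positivity), mul_comm]
  exact (two_mul_gap_mul_trace_sq_le_doubleCommutator hH hV hρ hHρ hPV hgap).trans hD

end Hermitian

/-! ### Vector / sector forms over `Matrix.minEnergyOn` -/

section Sector

variable {H A : Matrix m m ℂ} {ψ : m → ℂ} {ω : ℝ}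

/-- The sector energy bounds every Rayleigh quotient of the sector: for `v ∈ K`,
`minEnergyOn H K · ⟨v,v⟩ ≤ Re⟨v, Hv⟩` (Tasaki (2020) §2.2; `v = 0` allowed). [cite: Tasaki2020, §2.2] -/
theorem minEnergyOn_mul_le_rayleigh_of_mem (hH : H.IsHermitian) (K : Submodule ℂ (m → ℂ)) {v : m → ℂ}
    (hv : v ∈ K) : H.minEnergyOn K * (star v ⬝ᵥ v).re ≤ (star v ⬝ᵥ H *ᵥ v).re := by
  by_cases hv0 : v = 0
  · simp [hv0]
  obtain ⟨c, hc, hc1⟩ := exists_smul_unit hv0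
  have hle : H.minEnergyOn K ≤ (star (c • v) ⬝ᵥ H *ᵥ (c • v)).re := by
    refine csInf_le ⟨H.groundEnergy, ?_⟩ ⟨c • v, K.smul_mem c hv, hc1, rfl⟩
    rintro E ⟨φ, -, hφ1, rfl⟩
    exact Matrix.groundEnergy_le_rayleigh_holds hH φ hφ1
  -- `⟨cv, X cv⟩ = |c|² ⟨v, Xv⟩`
  have hcc : star c * c = ((Complex.normSq c : ℝ) : ℂ) := by
    rw [Complex.star_def, Complex.normSq_eq_conj_mul_self]
  have hsc : ∀ X : Matrix m m ℂ, star (c • v) ⬝ᵥ X *ᵥ (c • v) = ((Complex.normSq c : ℝ) : ℂ) * (star v ⬝ᵥ X *ᵥ v) := by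
    intro X
    rw [star_smul, mulVec_smul, smul_dotProduct, dotProduct_smul, smul_smul, hcc, smul_eq_mul]
  have h1 : ((Complex.normSq c : ℝ) : ℂ) * (star v ⬝ᵥ v) = 1 := by
    have := hsc 1
    rwa [one_mulVec, one_mulVec, hc1, eq_comm] at this
  have hpos : 0 < Complex.normSq c := Complex.normSq_pos.2 hc
  have h1re : Complex.normSq c * (star v ⬝ᵥ v).re = 1 := by
    have := congrArg Complex.re h1
    rwa [Complex.re_ofReal_mul, Complex.one_re] at this
  rw [hsc H, Complex.re_ofReal_mul] at hle
  -- `E_K · ⟨v,v⟩ = E_K / |c|² ≤ ⟨v,Hv⟩`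
  have hvv : (star v ⬝ᵥ v).re = (Complex.normSq c)⁻¹ := by
    field_simp
    linarith
  rw [hvv, ← div_eq_mul_inv, div_le_iff₀ hpos]
  linarith

/-- **One-sided spectral step, sector form.** For a vector `ψ` with `Hψ = E₀ψ`, an operator `A` with
`Aψ ∈ K` and a sector energy `minEnergyOn H K ≥ E₀ + ω`: `ω · ‖Aψ‖² ≤ Re⟨Aψ, (H − E₀)Aψ⟩`.
[cite: PitaevskiiStringari1991, §2] [cite: Tasaki2020, §2.2] -/
theorem gap_mul_normSq_le_of_mem_sector (hH : H.IsHermitian) (K : Submodule ℂ (m → ℂ))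
    (hAψ : A *ᵥ ψ ∈ K) (hK : H.groundEnergy + ω ≤ H.minEnergyOn K) :
    ω * (star (A *ᵥ ψ) ⬝ᵥ (A *ᵥ ψ)).re ≤
      (star (A *ᵥ ψ) ⬝ᵥ (H - (H.groundEnergy : ℂ) • 1) *ᵥ (A *ᵥ ψ)).re := by
  have h := minEnergyOn_mul_le_rayleigh_of_mem hH K hAψ
  have hnn : 0 ≤ (star (A *ᵥ ψ) ⬝ᵥ (A *ᵥ ψ)).re := (Complex.nonneg_iff.1 (dotProduct_star_self_nonneg _)).1
  rw [sub_mulVec, dotProduct_sub, smul_mulVec, one_mulVec, dotProduct_smul, Complex.sub_re,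
    smul_eq_mul, Complex.re_ofReal_mul]
  nlinarith

/-- The vector double-commutator identity: for `Hψ = E₀ψ` (`H` Hermitian, `E₀` real),
`⟨ψ,[A†,[H,A]]ψ⟩ = ⟨Aψ,(H−E₀)Aψ⟩ + ⟨A†ψ,(H−E₀)A†ψ⟩`. [cite: PitaevskiiStringari1991, §2] -/
theorem dotProduct_doubleCommutator_eq (hH : H.IsHermitian) (hψ : H *ᵥ ψ = (H.groundEnergy : ℂ) • ψ) :
    star ψ ⬝ᵥ (Aᴴ * (H * A - A * H) - (H * A - A * H) * Aᴴ) *ᵥ ψ =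
      star (A *ᵥ ψ) ⬝ᵥ (H - (H.groundEnergy : ℂ) • 1) *ᵥ (A *ᵥ ψ) +
        star (Aᴴ *ᵥ ψ) ⬝ᵥ (H - (H.groundEnergy : ℂ) • 1) *ᵥ (Aᴴ *ᵥ ψ) := by
  have hρ := trace_doubleCommutator_eq_of_groundSupported (A := A)
    (mul_vecMulVec_star_of_mulVec_eq' hψ) (vecMulVec_star_mul_of_mulVec_eq' hH hψ)
  rw [trace_vecMulVec_mul', trace_vecMulVec_mul', trace_vecMulVec_mul'] at hρ
  rw [hρ, ← mulVec_mulVec, ← mulVec_mulVec, ← mulVec_mulVec, ← mulVec_mulVec,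
    dotProduct_mulVec (star ψ) Aᴴ, dotProduct_mulVec (star ψ) A, vecMul_conjTranspose, star_star,
    ← conjTranspose_conjTranspose A, vecMul_conjTranspose, conjTranspose_conjTranspose, star_star]
where
  /-- `Tr((x y) M) = y ⬝ (M x)`. [folklore] -/
  trace_vecMulVec_mul' {x y : m → ℂ} {M : Matrix m m ℂ} : (vecMulVec x y * M).trace = y ⬝ᵥ (M *ᵥ x) := by
    simp only [Matrix.trace, Matrix.diag_apply, Matrix.mul_apply, vecMulVec_apply, dotProduct,
      mulVec, Finset.mul_sum]
    rw [Finset.sum_comm]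
    refine Finset.sum_congr rfl fun j _ => Finset.sum_congr rfl fun i _ => ?_
    ring
  /-- `H (ψ ψ†) = E₀ (ψ ψ†)`. [folklore] -/
  mul_vecMulVec_star_of_mulVec_eq' {H : Matrix m m ℂ} {ψ : m → ℂ}
      (hψ : H *ᵥ ψ = (H.groundEnergy : ℂ) • ψ) :
      H * vecMulVec ψ (star ψ) = (H.groundEnergy : ℂ) • vecMulVec ψ (star ψ) := by
    ext i j
    have h := congrFun hψ i
    simp only [mulVec, dotProduct, Pi.smul_apply, smul_eq_mul] at h
    simp only [Matrix.mul_apply, vecMulVec_apply, Matrix.smul_apply, smul_eq_mul, ← mul_assoc,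
      ← Finset.sum_mul, h]
  /-- `(ψ ψ†) H = E₀ (ψ ψ†)` for Hermitian `H`. [folklore] -/
  vecMulVec_star_mul_of_mulVec_eq' {H : Matrix m m ℂ} {ψ : m → ℂ} (hH : H.IsHermitian)
      (hψ : H *ᵥ ψ = (H.groundEnergy : ℂ) • ψ) :
      vecMulVec ψ (star ψ) * H = (H.groundEnergy : ℂ) • vecMulVec ψ (star ψ) := by
    have h := congrArg conjTranspose (mul_vecMulVec_star_of_mulVec_eq' hψ)
    rwa [conjTranspose_mul, conjTranspose_smul, hH.eq, conjTranspose_vecMulVec, star_star,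
      Complex.star_def, Complex.conj_ofReal] at h

/-- **`ω · S ≤ D`, sector form.** For `Hψ = E₀ψ` with `Aψ ∈ Kp`, `A†ψ ∈ Km` and both sector energies
`≥ E₀ + ω`: `ω · (‖Aψ‖² + ‖A†ψ‖²) ≤ Re⟨ψ,[A†,[H,A]]ψ⟩` — for a momentum-`q` pair mode on a torus,
`K_± =` the `(N ∓ 2, ±q)` sectors and `ω =` their yrast gap above `E₀`. [cite: Feynman1954, §III]
[cite: PitaevskiiStringari1991, §2] -/
theorem gap_mul_fluctuation_le_doubleCommutator_of_mem_sectors (hH : H.IsHermitian)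
    (hψ : H *ᵥ ψ = (H.groundEnergy : ℂ) • ψ) (Kp Km : Submodule ℂ (m → ℂ))
    (hA : A *ᵥ ψ ∈ Kp) (hA' : Aᴴ *ᵥ ψ ∈ Km) (hKp : H.groundEnergy + ω ≤ H.minEnergyOn Kp)
    (hKm : H.groundEnergy + ω ≤ H.minEnergyOn Km) :
    ω * ((star (A *ᵥ ψ) ⬝ᵥ (A *ᵥ ψ)).re + (star (Aᴴ *ᵥ ψ) ⬝ᵥ (Aᴴ *ᵥ ψ)).re) ≤
      (star ψ ⬝ᵥ (Aᴴ * (H * A - A * H) - (H * A - A * H) * Aᴴ) *ᵥ ψ).re := by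
  rw [dotProduct_doubleCommutator_eq hH hψ, Complex.add_re, mul_add]
  exact add_le_add (gap_mul_normSq_le_of_mem_sector hH Kp hA hKp)
    (gap_mul_normSq_le_of_mem_sector hH Km hA' hKm)

end Sector

end Literature.MathematicalPhysics.QuantumLattice
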